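import Mathlib
import Literature.LinearAlgebra.Matrix.PermanentLaplace
import Summits.ValiantsHypothesis.ValiantsHypothesis.Theorems.ValuativeGCTValuativeFlipPencilBorderTools

/-!
# Upper cofactors of lower-Hessenberg matrices are products (crux `ValuativeGCT.ValuativeFlip`,
# stmt-ValiantsHypothesis-12624; wall-breaker k1 gen 1, pencil `HB_n` for `stub_fourRowPencilRank`)

Helper file (`--supports stmt-ValiantsHypothesis-12624`).  The STRUCTURE THEOREM behind the negative charge
classes of the open Hessenberg four-band pencil `HB_n` (`Cruxes/ValuativeFlip/AxisK1G1HessenbergPencil.md` §3):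
for a matrix `A` over a commutative ring with `A r c = 0` whenever `c + 1 < r` ("lower bandwidth one") and
`i ≤ j`, the permanental cofactor deleting row `i` and column `j` is

  `per A(i | j) = (∏_{i < r ≤ j} A r (r-1)) · per A[< i] · per A[> j]`,

because the minor is block upper triangular with diagonal blocks `A[< i]`, an upper TRIANGULAR block with
diagonal `A_{r,r-1}`, and `A[> j]` (the permutation's cycle through the deleted entry is forced to be
`i → j → j-1 → ⋯ → i+1 → i`).  For the pencil this is `Per_{ij} = (∏ c_r) y₀^{j-i} Z_{[1,i-1]} Z_{[j+1,n]}`.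
Tools proved on the way (all folklore): the permanent of a block upper triangular matrix is the product of
the diagonal blocks (`hb_permanent_fromBlocks_zero₂₁`, the permanent twin of `Matrix.det_fromBlocks_zero₂₁`;
`hb_permanent_split` for a splitting point of `Fin n`), and of an upper triangular matrix the product of the
diagonal (`hb_permanent_of_upperTriangular`).
-/

set_option linter.dupNamespace false

namespace Summit.ValiantsHypothesis.ValiantsHypothesis.Theorems.ValuativeFlip

open scoped BigOperators Matrix
open Equiv Finset

section Blocks

variable {R : Type*} [CommRing R]

/-- **Permanent of a block upper triangular matrix** (Sum-indexed blocks): `per [[A, B], [0, D]] = per A · per D`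
— permutations not preserving the two blocks meet the zero block (the permanent twin of
`Matrix.det_fromBlocks_zero₂₁`, same proof without signs). [Minc 1978 §1; folklore] -/
theorem hb_permanent_fromBlocks_zero₂₁ {m n : Type*} [Fintype m] [Fintype n] [DecidableEq m] [DecidableEq n]
    (A : Matrix m m R) (B : Matrix m n R) (D : Matrix n n R) :
    (Matrix.fromBlocks A B 0 D).permanent = A.permanent * D.permanent := by
  classical
  unfold Matrix.permanent
  symm
  rw [sum_mul_sum, ← sum_product', univ_product_univ]
  rw [← sum_subset (M := R) (subset_univ ((Perm.sumCongrHom m n).range : Set (Perm (m ⊕ n))).toFinset)]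
  · refine sum_nbij (fun σ ↦ σ.fst.sumCongr σ.snd) ?_ ?_ ?_ ?_
    · intro σ₁₂ _
      simp
    · intro σ₁ _ σ₂ _ h
      have h2 : ∀ x, Perm.sumCongr σ₁.fst σ₁.snd x = Perm.sumCongr σ₂.fst σ₂.snd x :=
        DFunLike.congr_fun h
      simp only [Sum.map_inr, Sum.map_inl, Perm.sumCongr_apply, Sum.forall, Sum.inl.injEq,
        Sum.inr.injEq] at h2
      ext x
      · exact h2.left x
      · exact h2.right x
    · intro σ hσ
      rw [mem_coe, Set.mem_toFinset] at hσ
      obtain ⟨σ₁₂, hσ₁₂⟩ := hσ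
      exact ⟨σ₁₂, by simp, hσ₁₂⟩
    · simp only [Prod.forall, mem_univ, forall_true_left]
      intro σ₁ σ₂
      rw [Fintype.prod_sum_type]
      simp [Equiv.sumCongr_apply, Matrix.fromBlocks_apply₁₁, Matrix.fromBlocks_apply₂₂]
  · rintro σ - hσn
    have h1 : ¬∀ x, ∃ y, Sum.inl y = σ (Sum.inl x) := by
      rw [Set.mem_toFinset] at hσn
      simpa only [Set.MapsTo, Set.mem_range, forall_exists_index, forall_apply_eq_imp_iff] using
        mt Equiv.Perm.mem_sumCongrHom_range_of_perm_mapsTo_inl hσn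
    obtain ⟨a, ha⟩ := not_forall.mp h1
    rcases hx : σ (Sum.inl a) with a2 | b
    · exact absurd hx.symm ((not_exists.mp ha) a2)
    · rw [Finset.prod_eq_zero (Finset.mem_univ (Sum.inl a))]
      rw [hx, Matrix.fromBlocks_apply₂₁, Matrix.zero_apply]

/-- **Permanent of an upper triangular matrix** = product of the diagonal (expand along column `0` and recurse).
[folklore] -/
theorem hb_permanent_of_upperTriangular :
    ∀ {k : ℕ} (T : Matrix (Fin k) (Fin k) R), (∀ x y : Fin k, y < x → T x y = 0) → T.permanent = ∏ x, T x x := by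
  intro k
  induction k with
  | zero => intro T _; simp [Matrix.permanent]
  | succ k ih =>
    intro T hT
    rw [Matrix.permanent_eq_sum_column T 0, Fin.sum_univ_succ, Fin.prod_univ_succ]
    have hrest : ∑ i : Fin k, T i.succ 0 * (T.submatrix i.succ.succAbove (0 : Fin (k + 1)).succAbove).permanent = 0 :=
      Finset.sum_eq_zero fun i _ => by rw [hT _ _ (Fin.succ_pos i), zero_mul]
    rw [hrest, add_zero, Fin.succAbove_zero]
    congr 1
    rw [ih (T.submatrix Fin.succ Fin.succ) fun x y hxy => hT _ _ (Fin.succ_lt_succ_iff.mpr hxy)]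
    rfl

/-- Permanent of a block upper triangular matrix, `Fin (p + q)`-indexed version: if the entries with column
`< p ≤` row vanish then `per M = per M[castAdd] · per M[natAdd]`. [folklore] -/
theorem hb_permanent_castAdd_natAdd {p q : ℕ} (M : Matrix (Fin (p + q)) (Fin (p + q)) R)
    (hM : ∀ r c : Fin (p + q), (c : ℕ) < p → p ≤ (r : ℕ) → M r c = 0) :
    M.permanent = (M.submatrix (Fin.castAdd q) (Fin.castAdd q)).permanent *
      (M.submatrix (Fin.natAdd p) (Fin.natAdd p)).permanent := by
  rw [← Matrix.permanent_submatrix_equiv finSumFinEquiv M,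
    ← Matrix.fromBlocks_toBlocks (M.submatrix finSumFinEquiv finSumFinEquiv)]
  have h21 : (M.submatrix ⇑finSumFinEquiv ⇑finSumFinEquiv).toBlocks₂₁ = 0 := by
    ext x y
    simp only [Matrix.toBlocks₂₁, Matrix.of_apply, Matrix.submatrix_apply, finSumFinEquiv_apply_right,
      finSumFinEquiv_apply_left, Matrix.zero_apply]
    exact hM _ _ (by simp) (by simp)
  rw [h21, hb_permanent_fromBlocks_zero₂₁]
  rfl

/-- Permanent of a block upper triangular matrix, splitting-point version on `Fin n`: if `p ≤ n` and the entries
with column `< p ≤` row vanish then `per M = per M[< p] · per M[≥ p]`. [folklore] -/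
theorem hb_permanent_split {n : ℕ} (M : Matrix (Fin n) (Fin n) R) (p : ℕ) (hp : p ≤ n)
    (hM : ∀ r c : Fin n, (c : ℕ) < p → p ≤ (r : ℕ) → M r c = 0) :
    M.permanent = (M.submatrix (Fin.castLE hp) (Fin.castLE hp)).permanent *
      (M.submatrix (fun x : Fin (n - p) => (⟨p + x, by omega⟩ : Fin n))
        (fun x : Fin (n - p) => (⟨p + x, by omega⟩ : Fin n))).permanent := by
  set e : Fin (p + (n - p)) ≃ Fin n := finCongr (by omega) with he
  have h1 : (M.submatrix e e).submatrix (Fin.castAdd (n - p)) (Fin.castAdd (n - p)) =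
      M.submatrix (Fin.castLE hp) (Fin.castLE hp) := by
    ext a b
    simp only [Matrix.submatrix_apply]
    congr 1
  have h2 : (M.submatrix e e).submatrix (Fin.natAdd p) (Fin.natAdd p) =
      M.submatrix (fun x : Fin (n - p) => (⟨p + x, by omega⟩ : Fin n))
        (fun x : Fin (n - p) => (⟨p + x, by omega⟩ : Fin n)) := by
    ext a b
    simp only [Matrix.submatrix_apply]
    congr 1
  rw [← Matrix.permanent_submatrix_equiv e M,
    hb_permanent_castAdd_natAdd (M.submatrix e e) fun r c hc hr => hM _ _ (by simpa [he] using hc)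
      (by simpa [he] using hr), h1, h2]

end Blocks

section Hessenberg

/-- **Upper cofactors of a lower-Hessenberg matrix are products.**  If `A r c = 0` whenever `c + 1 < r` and
`i ≤ j`, then the permanent of `A` with row `i` and column `j` deleted is
`(∏_{i < r ≤ j} A r (r-1)) · per A[< i] · per A[> j]`: the minor is block upper triangular with diagonal blocks
`A[< i]`, the upper triangular block `(A (i+1+x) (i+y))_{x,y}` and `A[> j]`. [folklore; AxisK1G1HessenbergPencil.md §3] -/
theorem hb_upper_cofactor {R : Type*} [CommRing R] {n : ℕ} (A : Matrix (Fin (n + 1)) (Fin (n + 1)) R)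
    (hA : ∀ r c : Fin (n + 1), (c : ℕ) + 1 < r → A r c = 0) (i j : Fin (n + 1)) (hij : i ≤ j) :
    (A.submatrix i.succAbove j.succAbove).permanent =
      (∏ x : Fin ((j : ℕ) - i), A ⟨(i : ℕ) + x + 1, by omega⟩ ⟨(i : ℕ) + x, by omega⟩) *
      (A.submatrix (Fin.castLE (show (i : ℕ) ≤ n + 1 by omega)) (Fin.castLE (show (i : ℕ) ≤ n + 1 by omega))).permanent *
      (A.submatrix (fun x : Fin (n - j) => (⟨(j : ℕ) + 1 + x, by omega⟩ : Fin (n + 1)))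
        (fun x : Fin (n - j) => (⟨(j : ℕ) + 1 + x, by omega⟩ : Fin (n + 1)))).permanent := by
  -- values of `succAbove`
  have hrow : ∀ r : Fin n, (i : ℕ) ≤ r → (i.succAbove r : ℕ) = r + 1 := fun r hr => by
    rw [Fin.succAbove_of_le_castSucc _ _ (Fin.le_def.mpr (by simpa using hr)), Fin.val_succ]
  have hrow' : ∀ r : Fin n, (r : ℕ) < i → (i.succAbove r : ℕ) = r := fun r hr => by
    rw [Fin.succAbove_of_castSucc_lt _ _ (Fin.lt_def.mpr (by simpa using hr)), Fin.val_castSucc]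
  have hcol : ∀ c : Fin n, (j : ℕ) ≤ c → (j.succAbove c : ℕ) = c + 1 := fun c hc => by
    rw [Fin.succAbove_of_le_castSucc _ _ (Fin.le_def.mpr (by simpa using hc)), Fin.val_succ]
  have hcol' : ∀ c : Fin n, (c : ℕ) < j → (j.succAbove c : ℕ) = c := fun c hc => by
    rw [Fin.succAbove_of_castSucc_lt _ _ (Fin.lt_def.mpr (by simpa using hc)), Fin.val_castSucc]
  have hzero : ∀ (r c : Fin (n + 1)), (c : ℕ) + 1 < r → A r c = 0 := hA
  -- first split at `p = j`
  have hj : (j : ℕ) ≤ n := by omega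
  rw [hb_permanent_split (A.submatrix i.succAbove j.succAbove) j hj fun r c hc hr => by
    rw [Matrix.submatrix_apply]
    exact hzero _ _ (by rw [hrow r (by omega), hcol' c hc]; omega)]
  -- the lower-right block is `A[> j]`
  have h3 : ((A.submatrix i.succAbove j.succAbove).submatrix (fun x : Fin (n - j) => (⟨j + x, by omega⟩ : Fin n))
      (fun x : Fin (n - j) => (⟨j + x, by omega⟩ : Fin n))) =
      A.submatrix (fun x : Fin (n - j) => (⟨(j : ℕ) + 1 + x, by omega⟩ : Fin (n + 1)))
        (fun x : Fin (n - j) => (⟨(j : ℕ) + 1 + x, by omega⟩ : Fin (n + 1))) := by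
    ext a b
    simp only [Matrix.submatrix_apply]
    congr 1
    · exact Fin.ext (by rw [hrow _ (by simp; omega)]; simp; omega)
    · exact Fin.ext (by rw [hcol _ (by simp)]; simp; omega)
  rw [h3]
  -- second split of the upper-left block at `p = i`
  have hi : (i : ℕ) ≤ j := hij
  rw [hb_permanent_split ((A.submatrix i.succAbove j.succAbove).submatrix (Fin.castLE hj) (Fin.castLE hj)) i hi
    fun r c hc hr => by
      simp only [Matrix.submatrix_apply]
      refine hzero _ _ ?_
      rw [hrow _ (by simpa using hr), hcol' _ (by simp)]
      simp only [Fin.val_castLE]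
      omega]
  -- the upper-left block is `A[< i]`
  have h1 : (((A.submatrix i.succAbove j.succAbove).submatrix (Fin.castLE hj) (Fin.castLE hj)).submatrix
      (Fin.castLE hi) (Fin.castLE hi)) =
      A.submatrix (Fin.castLE (show (i : ℕ) ≤ n + 1 by omega)) (Fin.castLE (show (i : ℕ) ≤ n + 1 by omega)) := by
    ext a b
    simp only [Matrix.submatrix_apply]
    congr 1
    · exact Fin.ext (by rw [hrow' _ (by simp)]; simp)
    · exact Fin.ext (by rw [hcol' _ (by simp; omega)]; simp)
  -- the middle block is upper triangular with diagonal `A (i+x+1) (i+x)`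
  have h2 : (((A.submatrix i.succAbove j.succAbove).submatrix (Fin.castLE hj) (Fin.castLE hj)).submatrix
      (fun x : Fin ((j : ℕ) - i) => (⟨i + x, by omega⟩ : Fin j))
      (fun x : Fin ((j : ℕ) - i) => (⟨i + x, by omega⟩ : Fin j))).permanent =
      ∏ x : Fin ((j : ℕ) - i), A ⟨(i : ℕ) + x + 1, by omega⟩ ⟨(i : ℕ) + x, by omega⟩ := by
    rw [hb_permanent_of_upperTriangular]
    · refine Finset.prod_congr rfl fun x _ => ?_
      simp only [Matrix.submatrix_apply]
      congr 1
      · exact Fin.ext (by rw [hrow _ (by simp)]; simp)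
      · exact Fin.ext (by rw [hcol' _ (by simp; omega)]; simp)
    · intro x y hxy
      simp only [Matrix.submatrix_apply]
      refine hzero _ _ ?_
      rw [hrow _ (by simp), hcol' _ (by simp; omega)]
      simp only [Fin.val_castLE]
      have : (y : ℕ) < x := hxy
      omega
  rw [h1, h2]
  ring

end Hessenberg

section Pencil

open Literature.Computability.AlgebraicComplexity

/-- **Upper generators of a lower-Hessenberg pencil factor** (the form used for `HB_n`): for an algebra-valued
point `φ` of the generic `(n+1) × (n+1)` matrix with `φ (r, c) = 0` whenever `c + 1 < r`, and `i ≤ j`,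
`(∂_{ij} per_{n+1})(φ) = (∏_{i < r ≤ j} φ (r, r-1)) · per (φ|_{< i}) · per (φ|_{> j})`.  For `HB_n`
(`φ (r, r-1) = c_r y₀`) this is `Per_{ij} = (∏ c_r) · y₀^{j-i} · Z_{[1,i-1]} · Z_{[j+1,n]}`, the closed form of
every generator of a negative charge class. [folklore; AxisK1G1HessenbergPencil.md §3] -/
theorem hb_aeval_pderiv_perPoly_upper {K A : Type*} [CommRing K] [CommRing A] [Algebra K A] {n : ℕ}
    (φ : Fin (n + 1) × Fin (n + 1) → A) (hφ : ∀ r c : Fin (n + 1), (c : ℕ) + 1 < r → φ (r, c) = 0)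
    (i j : Fin (n + 1)) (hij : i ≤ j) :
    MvPolynomial.aeval φ (MvPolynomial.pderiv (i, j) (perPoly (Fin (n + 1)) K)) =
      (∏ x : Fin ((j : ℕ) - i), φ (⟨(i : ℕ) + x + 1, by omega⟩, ⟨(i : ℕ) + x, by omega⟩)) *
      (Matrix.of fun a b : Fin i => φ (Fin.castLE (show (i : ℕ) ≤ n + 1 by omega) a,
        Fin.castLE (show (i : ℕ) ≤ n + 1 by omega) b)).permanent *
      (Matrix.of fun a b : Fin (n - j) => φ ((⟨(j : ℕ) + 1 + a, by omega⟩ : Fin (n + 1)),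
        (⟨(j : ℕ) + 1 + b, by omega⟩ : Fin (n + 1)))).permanent := by
  rw [pb_aeval_pderiv_perPoly, hb_upper_cofactor (Matrix.of fun r c => φ (r, c)) (fun r c h => hφ r c h) i j hij]
  rfl

end Pencil

end Summit.ValiantsHypothesis.ValiantsHypothesis.Theorems.ValuativeFlip
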